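import Summits.NavierStokesRegularity.NavierStokesRegularity.Theorems.CorkscrewDynamoCorkscrewProfileSubcriticalStretchingSteady
import Summits.NavierStokesRegularity.NavierStokesRegularity.Theorems.CorkscrewDynamoCorkscrewProfileVorticitySqTransport
import Summits.NavierStokesRegularity.NavierStokesRegularity.Theorems.CorkscrewDynamoCorkscrewProfileAncientSubsolutionLiouville
import Summits.NavierStokesRegularity.NavierStokesRegularity.Theorems.CorkscrewDynamoCorkscrewProfileTypeIGradientBound
import Summits.NavierStokesRegularity.NavierStokesRegularity.Theorems.CorkscrewDynamoCorkscrewProfileStrictCoRotation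
import Summits.NavierStokesRegularity.NavierStokesRegularity.Theorems.CorkscrewDynamoCorkscrewProfileNormalForm
import Summits.NavierStokesRegularity.NavierStokesRegularity.Theorems.QuantisedSymmetryPolyhedralDssProfileExistsStubClassicalOfOseenMildPast
import Literature.Analysis.FluidPDE.TaoEnstrophyLocalisation
import HarnessLib

/-!
# Route CorkscrewDynamo · crux `CorkscrewProfile` (stmt-NavierStokesRegularity-11282) — STRETCHING NECESSITY (lead c7 assembly)

Assembly of the stretching-necessity block of line `registered` (skeleton v17, lead c7) from the landed tool
stubs S1 `stub_subcriticalStretchingSteady` (p173219), S2 `stub_vorticitySqTransport` (p173450),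
S3 `stub_ancientSubsolutionNonpos` (p173670), S4 `stub_typeIGradientBound` (p173764). In similarity variables
the vorticity `Ω = (−t) ω` of an ancient solution is damped at unit rate (the route's "dilution tax"); only
stretching can pay for it. (B) `typeI_vorticity_eq_zero_of_subcritical_stretching` / `typeI_eq_zero_…`: a
classical solution on `ℝ³ × (−∞,0)` with `‖u(t,x)‖ ≤ C₀/(‖x‖ + √(−t))` and SUBCRITICAL stretching
`(−t)⟪ω, Du ω⟫ ≤ Λ‖ω‖²`, `Λ < 1`, vanishes: `w = (−t)^{2Λ}‖ω‖²` is a subsolution of `∂ₜw ≤ Δw − Dw[u]` (S2)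
bounded by `(‖curlCLM‖K)²(−t)^{2Λ−2} → 0` as `t → −∞` (S4), hence `≤ 0` (S3); curl-free div-free `O(1/‖x‖)`
slices vanish. Corollaries `exists_supercritical_stretching_of_ne_zero`, `typeIAncientMild_supercritical_stretching`,
`corkscrewProfile_supercritical_stretching` (EVERY corkscrew has, for every `Λ < 1`, a point with
`Λ‖ω‖² < (−t)⟪ω, Du ω⟫`: `sup (−t)σ ≥ 1`), `supercritical_stretching_core` (such points lie in
`‖x‖² ≤ (K/Λ)(−t)`). (A) `exists_supercritical_stretching_steady`, `rssProfileExists_supercritical_stretching`: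
a nontrivial RSS profile (witness of stmt-16274) has a point with `‖curl U‖² < ⟪curl U, DU (curl U)⟫` (S1).
Complements c5/c6's co-rotation necessity (WHERE the vorticity points) by HOW HARD it must be stretched.
-/

noncomputable section

open MeasureTheory Set Function Filter Topology InnerProductSpace Metric
open Literature.Analysis.FluidPDE Literature.Analysis.FluidPDE.PineauVicol2026
open scoped RealInnerProductSpace Laplacian ContDiff NNReal ENNReal

namespace Summit.NavierStokesRegularity.NavierStokesRegularity.Theorems.CorkscrewProfile.Birth

set_option linter.dupNamespace false

/-! ### Elementary `rpow` facts for the weight `(−t)^{2Λ}` -/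

/-- The constant of a Type-I bound `‖u(t,x)‖ ≤ C₀/(‖x‖ + √(−t))` on a nonempty past is nonnegative. [folklore] -/
theorem typeI_const_nonneg {C₀ : ℝ} {u : ℝ → EuclideanSpace ℝ (Fin 3) → EuclideanSpace ℝ (Fin 3)}
    (hI : ∀ t < 0, ∀ x, ‖u t x‖ ≤ C₀ / (‖x‖ + Real.sqrt (-t))) : 0 ≤ C₀ := by
  have h := hI (-1) (by norm_num) 0
  rw [norm_zero, zero_add, neg_neg, Real.sqrt_one, div_one] at h
  exact (norm_nonneg _).trans h

/-- A Type-I bound in space–time gives the Type-I bound in time: `‖u(t,x)‖ ≤ C₀/√(−t)`. [folklore] -/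
theorem typeI_time_bound {C₀ : ℝ} {u : ℝ → EuclideanSpace ℝ (Fin 3) → EuclideanSpace ℝ (Fin 3)}
    (hI : ∀ t < 0, ∀ x, ‖u t x‖ ≤ C₀ / (‖x‖ + Real.sqrt (-t))) :
    ∀ t < 0, ∀ x, ‖u t x‖ ≤ C₀ / Real.sqrt (-t) := by
  intro t ht x
  have hC₀ := typeI_const_nonneg hI
  have hs : 0 < Real.sqrt (-t) := Real.sqrt_pos.2 (by linarith)
  exact (hI t ht x).trans
    (div_le_div_of_nonneg_left hC₀ hs (le_add_of_nonneg_left (norm_nonneg _)))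

/-- A Type-I bound in space–time gives, on each slice, the profile decay `‖u(t,y)‖ ≤ C/(1 + ‖y‖)` with
`C = C₀ / min 1 √(−t)`. [folklore] -/
theorem typeI_slice_bound {C₀ : ℝ} {u : ℝ → EuclideanSpace ℝ (Fin 3) → EuclideanSpace ℝ (Fin 3)}
    (hI : ∀ t < 0, ∀ x, ‖u t x‖ ≤ C₀ / (‖x‖ + Real.sqrt (-t))) {t : ℝ} (ht : t < 0) :
    ∀ y, ‖u t y‖ ≤ C₀ / min 1 (Real.sqrt (-t)) / (1 + ‖y‖) := by
  intro y
  have hC₀ := typeI_const_nonneg hI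
  set s := Real.sqrt (-t) with hs
  have hs0 : 0 < s := Real.sqrt_pos.2 (by linarith)
  set m := min 1 s with hm
  have hm0 : 0 < m := lt_min one_pos hs0
  have hm1 : m ≤ 1 := min_le_left _ _
  have hms : m ≤ s := min_le_right _ _
  have hy := norm_nonneg y
  have hkey : m * (1 + ‖y‖) ≤ ‖y‖ + s := by nlinarith
  calc ‖u t y‖ ≤ C₀ / (‖y‖ + s) := hI t ht y
    _ ≤ C₀ / (m * (1 + ‖y‖)) := div_le_div_of_nonneg_left hC₀ (by positivity) hkey
    _ = C₀ / m / (1 + ‖y‖) := by rw [div_div]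

/-! ### B: subcritical stretching kills Type-I ancient vorticity -/

/-- **Assembly B `typeI_vorticity_eq_zero_of_subcritical_stretching` — SUBCRITICAL STRETCHING KILLS TYPE-I ANCIENT
VORTICITY** (registered theorem of crux stmt-NavierStokesRegularity-11282, line `registered`, skeleton v17). A classical
Navier–Stokes solution on `ℝ³ × (−∞, 0)` with the Type-I bound `‖u(t,x)‖ ≤ C₀/(‖x‖ + √(−t))` and
`(−t) ⟪ω, Du ω⟫ ≤ Λ ‖ω‖²` everywhere for some `Λ < 1` (`ω = curl u(t)`) is irrotational: with `K` from S4,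
`w(t,x) = (−t)^{2Λ} ‖ω(t,x)‖²` is a subsolution of `∂ₜw ≤ Δw − Dw[u]` (S2 and the hypothesis) bounded by
`(‖curlCLM‖ K)² (−t)^{2Λ−2} → 0` (`t → −∞`), hence `≤ 0` by S3. In similarity variables: the vorticity of an
ancient Type-I flow is damped at unit rate and a stretching rate `< 1` cannot sustain it. [cite: MajdaBertozziCUP2002, §2.4 Prop. 2.4 eq. (2.110)] -/
theorem typeI_vorticity_eq_zero_of_subcritical_stretching {C₀ Λ : ℝ}
    {u : ℝ → EuclideanSpace ℝ (Fin 3) → EuclideanSpace ℝ (Fin 3)} {p : ℝ → EuclideanSpace ℝ (Fin 3) → ℝ}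
    (hsol : IsClassicalNSSolutionOn (Set.Iio 0) 1 0 u p)
    (hI : ∀ t < 0, ∀ x, ‖u t x‖ ≤ C₀ / (‖x‖ + Real.sqrt (-t))) (hΛ : Λ < 1)
    (hstretch : ∀ t < 0, ∀ x : EuclideanSpace ℝ (Fin 3),
      (-t) * ⟪curl (u t) x, fderiv ℝ (u t) x (curl (u t) x)⟫ ≤ Λ * ‖curl (u t) x‖ ^ 2) :
    ∀ t < 0, ∀ x, curl (u t) x = 0 := by
  obtain ⟨hφ2, hφc, hφt⟩ := stub_vorticitySqTransport hsol
  obtain ⟨K, hK0, hK⟩ := stub_typeIGradientBound hsol hI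
  -- the vorticity bound `‖ω(t,x)‖ ≤ c/(−t)`, `c = ‖curlCLM‖ K`
  set c : ℝ := ‖curlCLM‖ * K with hc
  have hc0 : 0 ≤ c := by positivity
  have hω : ∀ t < 0, ∀ x : EuclideanSpace ℝ (Fin 3), ‖curl (u t) x‖ ≤ c / (-t) := by
    intro t ht x
    have hnt : 0 < -t := by linarith
    have hm : -t ≤ (max ‖x‖ (Real.sqrt (-t))) ^ 2 := by
      calc -t = Real.sqrt (-t) ^ 2 := (Real.sq_sqrt hnt.le).symm
        _ ≤ (max ‖x‖ (Real.sqrt (-t))) ^ 2 :=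
          pow_le_pow_left₀ (Real.sqrt_nonneg _) (le_max_right _ _) 2
    calc ‖curl (u t) x‖ ≤ ‖curlCLM‖ * ‖fderiv ℝ (u t) x‖ := norm_curl_le (u t) x
      _ ≤ ‖curlCLM‖ * (K / (max ‖x‖ (Real.sqrt (-t))) ^ 2) :=
        mul_le_mul_of_nonneg_left (hK t ht x) (norm_nonneg curlCLM)
      _ ≤ ‖curlCLM‖ * (K / (-t)) :=
        mul_le_mul_of_nonneg_left (div_le_div_of_nonneg_left hK0 hnt hm) (norm_nonneg curlCLM)
      _ = c / (-t) := by rw [hc, mul_div_assoc]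
  -- the weight, the weighted enstrophy density, its time derivative and the bound
  set w : ℝ → EuclideanSpace ℝ (Fin 3) → ℝ := fun t x => (-t) ^ (2 * Λ) * ‖curl (u t) x‖ ^ 2 with hw
  set wt : ℝ → EuclideanSpace ℝ (Fin 3) → ℝ := fun t x =>
    (-1 * (2 * Λ) * (-t) ^ (2 * Λ - 1)) * ‖curl (u t) x‖ ^ 2 +
      (-t) ^ (2 * Λ) *
        ((Δ (fun y => ‖curl (u t) y‖ ^ 2)) x - fderiv ℝ (fun y => ‖curl (u t) y‖ ^ 2) x (u t x)
          + 2 * ⟪curl (u t) x, fderiv ℝ (u t) x (curl (u t) x)⟫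
          - 2 * frobeniusNormSq (fderiv ℝ (curl (u t)) x)) with hwt
  set b : ℝ → ℝ := fun t => c ^ 2 * (-t) ^ (2 * Λ - 2) with hb
  have hwfun : ∀ t, w t = ((-t) ^ (2 * Λ)) • fun y => ‖curl (u t) y‖ ^ 2 := by
    intro t; funext y; simp [hw, smul_eq_mul]
  -- (1) `C²` slices
  have hw2 : ∀ t < 0, ContDiff ℝ 2 (w t) := fun t ht => by
    simp only [hw]
    exact contDiff_const.mul (hφ2 t ht)
  -- (2) joint continuity
  have hwc : ContinuousOn (Function.uncurry w) (Set.Iio 0 ×ˢ Set.univ) := by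
    have h1 : ContinuousOn (fun q : ℝ × EuclideanSpace ℝ (Fin 3) => (-q.1) ^ (2 * Λ))
        (Set.Iio 0 ×ˢ Set.univ) := by
      refine ContinuousOn.rpow_const (continuous_neg.comp continuous_fst).continuousOn ?_
      rintro ⟨t, x⟩ hq
      have ht : t < 0 := hq.1
      exact Or.inl (show -t ≠ 0 by linarith)
    have h2 := h1.mul hφc
    refine h2.congr fun q _ => ?_
    rcases q with ⟨t, x⟩
    simp [hw, Function.uncurry]
  -- (3) the time derivative
  have hwt' : ∀ t < 0, ∀ x, HasDerivAt (fun s => w s x) (wt t x) t := by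
    intro t ht x
    have hpow : HasDerivAt (fun s : ℝ => (-s) ^ (2 * Λ)) (-1 * (2 * Λ) * (-t) ^ (2 * Λ - 1)) t :=
      (hasDerivAt_neg t).rpow_const (Or.inl (by linarith))
    have h := hpow.mul (hφt t ht x)
    simpa only [hw, hwt, Pi.mul_def] using h
  -- (4) the subsolution inequality
  have hsub : ∀ t < 0, ∀ x, wt t x ≤ (Δ (w t)) x - fderiv ℝ (w t) x (u t x) := by
    intro t ht x
    have hnt : 0 < -t := by linarith
    have hφd : DifferentiableAt ℝ (fun y => ‖curl (u t) y‖ ^ 2) x :=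
      ((hφ2 t ht).differentiable (by simp)) x
    have hΔ : (Δ (w t)) x = (-t) ^ (2 * Λ) * (Δ (fun y => ‖curl (u t) y‖ ^ 2)) x := by
      rw [hwfun t, InnerProductSpace.laplacian_smul _ (hφ2 t ht).contDiffAt, smul_eq_mul]
    have hD : fderiv ℝ (w t) x (u t x) =
        (-t) ^ (2 * Λ) * fderiv ℝ (fun y => ‖curl (u t) y‖ ^ 2) x (u t x) := by
      rw [hwfun t, fderiv_const_smul hφd]
      rfl
    -- abbreviations
    set A : ℝ := (-t) ^ (2 * Λ - 1) with hA
    set Pw : ℝ := (-t) ^ (2 * Λ) with hPw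
    have hA0 : 0 < A := Real.rpow_pos_of_pos hnt _
    have hPA : Pw = A * (-t) := by
      rw [hA, hPw, Real.rpow_sub_one hnt.ne' (2 * Λ), div_mul_cancel₀ _ hnt.ne']
    have hst := hstretch t ht x
    have hF := frobeniusNormSq_nonneg (fderiv ℝ (curl (u t)) x)
    rw [hΔ, hD]
    simp only [hwt]
    rw [← hA, ← hPw]
    set φ₀ := ‖curl (u t) x‖ ^ 2
    set L := (Δ (fun y => ‖curl (u t) y‖ ^ 2)) x
    set D := fderiv ℝ (fun y => ‖curl (u t) y‖ ^ 2) x (u t x)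
    set ip := ⟪curl (u t) x, fderiv ℝ (u t) x (curl (u t) x)⟫
    set F := frobeniusNormSq (fderiv ℝ (curl (u t)) x)
    rw [hPA]
    have h1 : A * ((-t) * ip) ≤ A * (Λ * φ₀) := mul_le_mul_of_nonneg_left hst hA0.le
    have h2 : 0 ≤ A * (-t) * F := mul_nonneg (mul_nonneg hA0.le hnt.le) hF
    nlinarith
  -- (5) the Type-I drift bound
  have hV := typeI_time_bound hI
  -- (6) the bound `w ≤ b`
  have hbd : ∀ t < 0, ∀ x, w t x ≤ b t := by
    intro t ht x
    have hnt : 0 < -t := by linarith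
    have hφle : ‖curl (u t) x‖ ^ 2 ≤ (c / (-t)) ^ 2 :=
      pow_le_pow_left₀ (norm_nonneg _) (hω t ht x) 2
    have hP0 : 0 ≤ (-t) ^ (2 * Λ) := (Real.rpow_pos_of_pos hnt _).le
    have hsplit : (-t) ^ (2 * Λ - 2) = (-t) ^ (2 * Λ) / (-t) ^ 2 := by
      rw [Real.rpow_sub hnt, Real.rpow_two]
    calc w t x = (-t) ^ (2 * Λ) * ‖curl (u t) x‖ ^ 2 := rfl
      _ ≤ (-t) ^ (2 * Λ) * (c / (-t)) ^ 2 := mul_le_mul_of_nonneg_left hφle hP0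
      _ = b t := by simp only [hb]; rw [hsplit, div_pow]; ring
  -- (7) `b` is monotone on `(−∞, 0)`
  have hbm : MonotoneOn b (Set.Iio 0) := by
    intro s hs t ht hst
    have hs0 : s < 0 := hs
    have ht0 : t < 0 := ht
    simp only [hb]
    refine mul_le_mul_of_nonneg_left ?_ (sq_nonneg c)
    exact Real.rpow_le_rpow_of_nonpos (by linarith) (by linarith) (by linarith)
  -- (8) `b → 0` as `t → −∞`
  have hb0 : Filter.Tendsto b Filter.atBot (nhds 0) := by
    have hy : 0 < 2 - 2 * Λ := by linarith
    have h1 : Tendsto (fun t : ℝ => (-t) ^ (-(2 - 2 * Λ))) atBot (nhds 0) :=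
      (tendsto_rpow_neg_atTop hy).comp tendsto_neg_atBot_atTop
    have h2 := h1.const_mul (c ^ 2)
    rw [mul_zero] at h2
    refine h2.congr fun t => ?_
    simp only [hb]
    congr 1
    ring_nf
  -- (9) the Liouville lemma
  have hle := stub_ancientSubsolutionNonpos hw2 hwc hwt' hsub hV hbd hbm hb0
  intro t ht x
  have hnt : 0 < -t := by linarith
  have h1 : (-t) ^ (2 * Λ) * ‖curl (u t) x‖ ^ 2 ≤ 0 := hle t ht x
  have hP : 0 < (-t) ^ (2 * Λ) := Real.rpow_pos_of_pos hnt _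
  have h2 : ‖curl (u t) x‖ ^ 2 ≤ 0 := by
    by_contra h
    push Not at h
    linarith [mul_pos hP h]
  have h3 : ‖curl (u t) x‖ ^ 2 = 0 := le_antisymm h2 (sq_nonneg _)
  exact norm_eq_zero.1 (pow_eq_zero_iff two_ne_zero |>.1 h3)

/-- **Assembly B′ `typeI_eq_zero_of_subcritical_stretching` — the Liouville theorem** (registered theorem of crux
stmt-NavierStokesRegularity-11282, line `registered`, skeleton v17). A classical Navier–Stokes solution on `ℝ³ × (−∞,0)`
with the Type-I bound `‖u(t,x)‖ ≤ C₀/(‖x‖ + √(−t))` and subcritical stretching `(−t)⟪ω, Du ω⟫ ≤ Λ‖ω‖²`, `Λ < 1`,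
vanishes on the past: each slice is curl-free (`typeI_vorticity_eq_zero_of_subcritical_stretching`), divergence-free and
`O(1/‖x‖)`, hence zero (`PineauVicol2026.eq_zero_of_curl_eq_zero_of_isDivFree_of_norm_le`). [cite: KNSS2009, Theorem 5.3 (the Liouville problem for Type-I ancient solutions)] -/
theorem typeI_eq_zero_of_subcritical_stretching {C₀ Λ : ℝ}
    {u : ℝ → EuclideanSpace ℝ (Fin 3) → EuclideanSpace ℝ (Fin 3)} {p : ℝ → EuclideanSpace ℝ (Fin 3) → ℝ}
    (hsol : IsClassicalNSSolutionOn (Set.Iio 0) 1 0 u p)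
    (hI : ∀ t < 0, ∀ x, ‖u t x‖ ≤ C₀ / (‖x‖ + Real.sqrt (-t))) (hΛ : Λ < 1)
    (hstretch : ∀ t < 0, ∀ x : EuclideanSpace ℝ (Fin 3),
      (-t) * ⟪curl (u t) x, fderiv ℝ (u t) x (curl (u t) x)⟫ ≤ Λ * ‖curl (u t) x‖ ^ 2) :
    ∀ t < 0, u t = 0 := by
  have hcurl := typeI_vorticity_eq_zero_of_subcritical_stretching hsol hI hΛ hstretch
  intro t ht
  have hU2 : ContDiff ℝ 2 (u t) := (hsol.contDiff_velocity ht).of_le (WithTop.coe_le_coe.2 le_top)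
  exact eq_zero_of_curl_eq_zero_of_isDivFree_of_norm_le hU2 (hcurl t ht) (hsol.divFree t ht)
    (typeI_slice_bound hI ht)

/-- **Type-I ancient flows stretch at the self-similar rate** (`exists_supercritical_stretching_of_ne_zero`). A classical
Type-I solution on `(−∞,0)` which is nonzero at some negative time has, for every `Λ < 1`, a point with
`Λ‖ω‖² < (−t)⟪ω, Du ω⟫`; in particular `sup_{t<0,x} (−t) σ(t,x) ≥ 1` for the stretching rate `σ = ⟪ω̂, S ω̂⟫`.
[cite: KNSS2009, Theorem 5.3 (the Liouville problem for Type-I ancient solutions)] -/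
theorem exists_supercritical_stretching_of_ne_zero {C₀ Λ : ℝ}
    {u : ℝ → EuclideanSpace ℝ (Fin 3) → EuclideanSpace ℝ (Fin 3)} {p : ℝ → EuclideanSpace ℝ (Fin 3) → ℝ}
    (hsol : IsClassicalNSSolutionOn (Set.Iio 0) 1 0 u p)
    (hI : ∀ t < 0, ∀ x, ‖u t x‖ ≤ C₀ / (‖x‖ + Real.sqrt (-t))) (hne : ∃ t < 0, u t ≠ 0) (hΛ : Λ < 1) :
    ∃ t < 0, ∃ x : EuclideanSpace ℝ (Fin 3),
      Λ * ‖curl (u t) x‖ ^ 2 < (-t) * ⟪curl (u t) x, fderiv ℝ (u t) x (curl (u t) x)⟫ := by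
  by_contra h
  push Not at h
  obtain ⟨t, ht, hut⟩ := hne
  exact hut (typeI_eq_zero_of_subcritical_stretching hsol hI hΛ h t ht)

/-- **The supercritical stretching happens in the parabolic core** (`supercritical_stretching_core`). With the constant `K`
of the Type-I gradient bound (S4), at any point where `Λ‖ω‖² < (−t)⟪ω, Du ω⟫` with `Λ > 0` one has
`‖x‖² < K(−t)/Λ`: indeed `⟪ω, Du ω⟫ ≤ ‖Du‖‖ω‖² ≤ K‖ω‖²/max(‖x‖,√(−t))²`. [cite: PineauVicol2026, Lemma 7.1] -/
theorem supercritical_stretching_core {C₀ : ℝ}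
    {u : ℝ → EuclideanSpace ℝ (Fin 3) → EuclideanSpace ℝ (Fin 3)} {p : ℝ → EuclideanSpace ℝ (Fin 3) → ℝ}
    (hsol : IsClassicalNSSolutionOn (Set.Iio 0) 1 0 u p)
    (hI : ∀ t < 0, ∀ x, ‖u t x‖ ≤ C₀ / (‖x‖ + Real.sqrt (-t))) :
    ∃ K : ℝ, 0 ≤ K ∧ ∀ (Λ : ℝ), 0 < Λ → ∀ t < 0, ∀ x : EuclideanSpace ℝ (Fin 3),
      Λ * ‖curl (u t) x‖ ^ 2 < (-t) * ⟪curl (u t) x, fderiv ℝ (u t) x (curl (u t) x)⟫ →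
        ‖x‖ ^ 2 < K * (-t) / Λ := by
  obtain ⟨K, hK0, hK⟩ := stub_typeIGradientBound hsol hI
  refine ⟨K, hK0, fun Λ hΛ t ht x hx => ?_⟩
  have hnt : 0 < -t := by linarith
  set m : ℝ := max ‖x‖ (Real.sqrt (-t)) with hm
  have hm0 : 0 < m := lt_max_of_lt_right (Real.sqrt_pos.2 hnt)
  set ζ := curl (u t) x with hζ
  -- `⟪ζ, Du ζ⟫ ≤ ‖Du‖ ‖ζ‖² ≤ K ‖ζ‖² / m²`
  have hip : ⟪ζ, fderiv ℝ (u t) x ζ⟫ ≤ K / m ^ 2 * ‖ζ‖ ^ 2 := by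
    calc ⟪ζ, fderiv ℝ (u t) x ζ⟫ ≤ ‖ζ‖ * ‖fderiv ℝ (u t) x ζ‖ := real_inner_le_norm _ _
      _ ≤ ‖ζ‖ * (‖fderiv ℝ (u t) x‖ * ‖ζ‖) :=
        mul_le_mul_of_nonneg_left (ContinuousLinearMap.le_opNorm _ _) (norm_nonneg _)
      _ = ‖fderiv ℝ (u t) x‖ * ‖ζ‖ ^ 2 := by ring
      _ ≤ K / m ^ 2 * ‖ζ‖ ^ 2 := mul_le_mul_of_nonneg_right (hK t ht x) (sq_nonneg _)
  -- so `Λ ‖ζ‖² < (−t) K ‖ζ‖² / m²`, whence `ζ ≠ 0` and `Λ m² < K(−t)`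
  have h1 : Λ * ‖ζ‖ ^ 2 < (-t) * (K / m ^ 2) * ‖ζ‖ ^ 2 := by
    have := mul_le_mul_of_nonneg_left hip hnt.le
    nlinarith
  have hζ0 : 0 < ‖ζ‖ ^ 2 := by
    rcases (sq_nonneg ‖ζ‖).eq_or_lt with h | h
    · rw [← h] at h1; simp at h1
    · exact h
  have h2 : Λ < (-t) * (K / m ^ 2) := lt_of_mul_lt_mul_right h1 hζ0.le
  have h3 : Λ * m ^ 2 < K * (-t) := by
    have hm2 : 0 < m ^ 2 := by positivity
    have e : (-t) * (K / m ^ 2) = K * (-t) / m ^ 2 := by ring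
    rw [e, lt_div_iff₀ hm2] at h2
    exact h2
  have hxm : ‖x‖ ^ 2 ≤ m ^ 2 := pow_le_pow_left₀ (norm_nonneg _) (le_max_left _ _) 2
  rw [lt_div_iff₀ hΛ]
  nlinarith

/-! ### Corollaries for the crux's objects -/

/-- **`typeIAncientMild_supercritical_stretching` — the Oseen-gauge form.** A nontrivial Type-I ancient mild solution in the
Oseen gauge (`IsTypeIAncientMild C₀ V`; classical on `(−∞,0)` for some pressure by
`exists_isClassicalNSSolutionOn_Iio_of_isTypeIAncientMild`, KNSS Prop. 4.1 + Fabes–Jones–Rivière) with the Type-I decay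
`HasTypeIDecay C₀ V` has supercritical stretching points for every `Λ < 1`. [cite: KNSS2009, Theorem 5.3 (the Liouville problem for Type-I ancient solutions)] -/
theorem typeIAncientMild_supercritical_stretching {C₀ Λ : ℝ}
    {V : ℝ → EuclideanSpace ℝ (Fin 3) → EuclideanSpace ℝ (Fin 3)}
    (hV : IsTypeIAncientMild C₀ V) (hdec : HasTypeIDecay C₀ V) (hne : ∃ t < 0, V t ≠ 0) (hΛ : Λ < 1) :
    ∃ t < 0, ∃ x : EuclideanSpace ℝ (Fin 3),
      Λ * ‖curl (V t) x‖ ^ 2 < (-t) * ⟪curl (V t) x, fderiv ℝ (V t) x (curl (V t) x)⟫ := by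
  obtain ⟨q, hcl⟩ :=
    Summit.NavierStokesRegularity.NavierStokesRegularity.Theorems.PolyhedralDssProfileExists.PolyhedralCell.exists_isClassicalNSSolutionOn_Iio_of_isTypeIAncientMild hV
  exact exists_supercritical_stretching_of_ne_zero hcl (fun t ht x => hdec t ht x) hne hΛ

/-- **`corkscrewProfile_supercritical_stretching` — EVERY CORKSCREW STRETCHES SUPERCRITICALLY.** If the crux
`CorkscrewDynamo.CorkscrewProfile` holds, its Oseen-gauge normal form (`corkscrewProfile_iff_smooth`, lead c3) is a nontrivial
Type-I ancient mild solution, rotated `c`-DSS about `e₃` with essential rotation, which for every `Λ < 1` has a point with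
`Λ‖ω‖² < (−t)⟪ω, DV ω⟫` (a corkscrew stretches some vortex line at least at the self-similar clock rate).
[cite: BradshawTsai2017CPDE, §5 Open Problem 5.1] -/
theorem corkscrewProfile_supercritical_stretching
    (h : Summit.NavierStokesRegularity.NavierStokesRegularity.Theses.CorkscrewDynamo.CorkscrewProfile) :
    ∃ (c θ C₀ : ℝ) (V : ℝ → EuclideanSpace ℝ (Fin 3) → EuclideanSpace ℝ (Fin 3)), 1 < c ∧
      IsTypeIAncientMild C₀ V ∧ IsRotatedDSS c (rotZLIE θ) V ∧ HasTypeIDecay C₀ V ∧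
      (∃ t < 0, ∃ x, rotZ θ (V t (rotZ (-θ) x)) ≠ V t x) ∧
      ∀ Λ < 1, ∃ t < 0, ∃ x : EuclideanSpace ℝ (Fin 3),
        Λ * ‖curl (V t) x‖ ^ 2 < (-t) * ⟪curl (V t) x, fderiv ℝ (V t) x (curl (V t) x)⟫ := by
  obtain ⟨c, θ, C₀, V, hc, hV, hdss, hdec, t, ht, x, hx⟩ := corkscrewProfile_iff_smooth.1 h
  have hne : ∃ t < 0, V t ≠ 0 := by
    refine ⟨t, ht, fun h0 => hx ?_⟩
    have hz : rotZ θ (0 : EuclideanSpace ℝ (Fin 3)) = 0 := by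
      ext i
      fin_cases i <;> simp
    simp [h0, hz]
  exact ⟨c, θ, C₀, V, hc, hV, hdss, hdec, ⟨t, ht, x, hx⟩,
    fun Λ hΛ => typeIAncientMild_supercritical_stretching hV hdec hne hΛ⟩

/-- **Corollary A `exists_supercritical_stretching_steady` — a nontrivial rotated Leray profile stretches supercritically
somewhere** (contrapositive of S1 `stub_subcriticalStretchingSteady`): for a smooth divergence-free solution of Perelman's
rotated Leray profile system (any `α`) with the profile Type-I decay and the derivative decay, `U ≠ 0` forces a point with
`‖curl U‖² < ⟪curl U, DU (curl U)⟫` (similarity stretching rate `> 1`, strictly, pointwise).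
[cite: Tsai1998, Lemma 5.1 (the maximum-principle step, the case α = 0)] -/
theorem exists_supercritical_stretching_steady {α C₀ K : ℝ}
    {U : EuclideanSpace ℝ (Fin 3) → EuclideanSpace ℝ (Fin 3)} {P : EuclideanSpace ℝ (Fin 3) → ℝ}
    (hU : ContDiff ℝ (⊤ : ℕ∞) U) (hP : ContDiff ℝ (⊤ : ℕ∞) P) (hdiv : VectorCalculus.IsDivFree U)
    (heq : ∀ y : EuclideanSpace ℝ (Fin 3),
      α • (rotGen (U y) - fderiv ℝ U y (rotGen y)) + (1 / 2 : ℝ) • U y + (1 / 2 : ℝ) • fderiv ℝ U y y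
        - (Δ U) y + fderiv ℝ U y (U y) + gradient P y = 0)
    (hdec : ∀ y : EuclideanSpace ℝ (Fin 3), ‖U y‖ ≤ C₀ / (1 + ‖y‖))
    (hD1 : ∀ y : EuclideanSpace ℝ (Fin 3), ‖fderiv ℝ U y‖ ≤ K / (1 + ‖y‖) ^ 2) (hne : U ≠ 0) :
    ∃ y : EuclideanSpace ℝ (Fin 3), ‖curl U y‖ ^ 2 < ⟪curl U y, fderiv ℝ U y (curl U y)⟫ := by
  by_contra h
  push Not at h
  exact hne (stub_subcriticalStretchingSteady hU hP hdiv heq hdec hD1 h)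

/-- **Corollary A′ `rssProfileExists_supercritical_stretching` — every witness of stmt-16274 stretches supercritically.**
`RssProfileExists` yields a smooth nontrivial rotated Leray profile (`rssData_rotatedLerayProfile`, lead c5) with the Type-I
derivative decay (`rssData_derivativeDecay`, lead c6), hence (Corollary A) a point with `‖curl U‖² < ⟪curl U, DU (curl U)⟫`.
[cite: PineauVicol2026, Conjecture 1.1 (arXiv:2607.09619 p. 3)] -/
theorem rssProfileExists_supercritical_stretching
    (h : Summit.NavierStokesRegularity.NavierStokesRegularity.Theses.FilamentSkeletonRss.RssProfileExists) :
    ∃ (α C₀ K : ℝ) (U : EuclideanSpace ℝ (Fin 3) → EuclideanSpace ℝ (Fin 3)) (P : EuclideanSpace ℝ (Fin 3) → ℝ),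
      α ≠ 0 ∧ U ≠ 0 ∧ ContDiff ℝ (⊤ : ℕ∞) U ∧ ContDiff ℝ (⊤ : ℕ∞) P ∧ VectorCalculus.IsDivFree U ∧
      (∀ y : EuclideanSpace ℝ (Fin 3),
        α • (rotGen (U y) - fderiv ℝ U y (rotGen y)) + (1 / 2 : ℝ) • U y + (1 / 2 : ℝ) • fderiv ℝ U y y
          - (Δ U) y + fderiv ℝ U y (U y) + gradient P y = 0) ∧
      (∀ y : EuclideanSpace ℝ (Fin 3), ‖U y‖ ≤ C₀ / (1 + ‖y‖)) ∧
      (∀ y : EuclideanSpace ℝ (Fin 3), ‖fderiv ℝ U y‖ ≤ K / (1 + ‖y‖) ^ 2) ∧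
      ∃ y : EuclideanSpace ℝ (Fin 3), ‖curl U y‖ ^ 2 < ⟪curl U y, fderiv ℝ U y (curl U y)⟫ := by
  obtain ⟨α, C₀, U, Rot, u, hα, hRot, hU2, hU0, hu1, hrss, hmild, hmeas, hC⟩ := h
  obtain ⟨P, hU, hP, hdiv, heq, hdec, -, -, -⟩ := rssData_rotatedLerayProfile hRot hU2 hu1 hrss hmild hmeas hC
  obtain ⟨K, -, hK⟩ := rssData_derivativeDecay hRot hU2 hu1 hrss hmild hmeas hC
  exact ⟨α, C₀, K, U, P, hα, hU0, hU, hP, hdiv, heq, hdec, fun y => (hK y).1,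
    exists_supercritical_stretching_steady hU hP hdiv heq hdec (fun y => (hK y).1) hU0⟩

/-- **Stretching necessity for the open stub, contrapositive packaging.** A Liouville theorem for smooth rotated Leray
profiles (`α ≠ 0`, Type-I profile decay, polynomial pressure, Type-I derivative decay) may now ASSUME a point of
supercritical stretching `‖curl U‖² < ⟪curl U, DU (curl U)⟫` (besides the co-rotation data of
`not_rssProfileExists_of_inBall_liouville`); if under this extra hypothesis `U = 0` follows, `RssProfileExists` (stmt-16274)
fails. [cite: PineauVicol2026, Conjecture 1.1 (arXiv:2607.09619 p. 3)] -/
theorem not_rssProfileExists_of_stretching_liouville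
    (h : ∀ (α C₀ M K : ℝ) (N : ℕ) (U : EuclideanSpace ℝ (Fin 3) → EuclideanSpace ℝ (Fin 3)) (P : EuclideanSpace ℝ (Fin 3) → ℝ),
      α ≠ 0 → ContDiff ℝ (⊤ : ℕ∞) U → ContDiff ℝ (⊤ : ℕ∞) P → VectorCalculus.IsDivFree U →
      (∀ y : EuclideanSpace ℝ (Fin 3),
        α • (rotGen (U y) - fderiv ℝ U y (rotGen y)) + (1 / 2 : ℝ) • U y + (1 / 2 : ℝ) • fderiv ℝ U y y
          - (Δ U) y + fderiv ℝ U y (U y) + gradient P y = 0) →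
      (∀ y : EuclideanSpace ℝ (Fin 3), ‖U y‖ ≤ C₀ / (1 + ‖y‖)) →
      (∀ y : EuclideanSpace ℝ (Fin 3), |P y| ≤ M * (1 + ‖y‖) ^ N) →
      (∀ y : EuclideanSpace ℝ (Fin 3), ‖fderiv ℝ U y‖ ≤ K / (1 + ‖y‖) ^ 2) →
      (∀ y : EuclideanSpace ℝ (Fin 3), ‖fderiv ℝ (curl U) y‖ ≤ K / (1 + ‖y‖) ^ 3) →
      (∃ y : EuclideanSpace ℝ (Fin 3), ‖curl U y‖ ^ 2 < ⟪curl U y, fderiv ℝ U y (curl U y)⟫) →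
      U = 0) :
    ¬ Summit.NavierStokesRegularity.NavierStokesRegularity.Theses.FilamentSkeletonRss.RssProfileExists := by
  intro hR
  obtain ⟨α, C₀, U, Rot, u, hα, hRot, hU2, hU0, hu1, hrss, hmild, hmeas, hC⟩ := hR
  obtain ⟨P, hU, hP, hdiv, heq, hdec, M, N, hPM⟩ := rssData_rotatedLerayProfile hRot hU2 hu1 hrss hmild hmeas hC
  obtain ⟨K, -, hK⟩ := rssData_derivativeDecay hRot hU2 hu1 hrss hmild hmeas hC
  exact hU0 (h α C₀ M K N U P hα hU hP hdiv heq hdec hPM (fun y => (hK y).1) (fun y => (hK y).2)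
    (exists_supercritical_stretching_steady hU hP hdiv heq hdec (fun y => (hK y).1) hU0))

end Summit.NavierStokesRegularity.NavierStokesRegularity.Theorems.CorkscrewProfile.Birth
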